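/-
Copyright (c) 2026 the pub-hodgecm-mathlib formalisation cell (harness21).  Prover seat hodgecm-mathlib-LH7-p06 (g0) (re-dealt to strike line L3 `stub_N6nsDyadic` by director
s1969 (a)), «(D-RAM) FOUR-FRAME» road of crux H413, line LH4, (β-BAL) Stage B, β-BOARD v1 (sub-dealer LH4-p05 (g8)) ROW R5 «G₃ ε-BOUNDARY TOWER», split R5a∕R5b with LH4-p18 (g0)
(bus 2026-09-04T15:28–15:32Z: INPUT = this seat, SUM + HEAD = LH4-p18): THE PER-LATTICE TWO-SLOT LABEL on the stratum `G₃ = (2ρ+s, 2ρ+s, 2ρ)` beyond the one-slot cell.  2026-09-04.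
-/
import Summits.HodgeConjecture.HodgeConjecture.Theorems.F0P3cDyRamTwoSlotLabelRead              -- ★ (LH4-p13 (g8), (L-lab-20a)): `valueClassLabel_latt_hnf_iff_normSign` (the top-A read on any HNF `(1 0 0; x ϖ^b 0; y z ϖ^c)`)
import Summits.HodgeConjecture.HodgeConjecture.Theorems.F0P3cDyRamDiagonalGluedStratumG3        -- ★ p861251 (this seat): `v_polarisation_latt_G3`, `v_gram_cancel_latt_G3_le`, `v_sub_le_of_mem_fixedUnitStabilizer_latt_G3`, `det_latt_G3_ne_zero`, `isNormalisedLattice_latt_G3`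
import Summits.HodgeConjecture.HodgeConjecture.Theorems.F0P3cDyRamDiagonalOrbitFibreTransport     -- ★ (LH4-p11 (g2)): `fibre_isCoset_zero` (the type-0 polarisations of a normalised `latt g` are ONE `S_F`-coset)
import Summits.HodgeConjecture.HodgeConjecture.Theorems.F0P3cDyRamStageOneBDefs                   -- ★ DEFS №5 (F0P3a-p01 (g36)): `mcOfRecord`; brings `mstarOfRecord`
import HarnessLib

/-!
# Crux `H413`, line LH4 «(D-RAM) FOUR-FRAME» — (β-BAL) Stage B, β-BOARD v1 ROW R5 «G₃ ε-BOUNDARY TOWER», THE PER-LATTICE INPUT (R5b):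
# on the G₃ normal form beyond the one-slot cell, the value-class label on the polarisation fibre `D·S_F` is `ω` of an EXPLICIT σ-fixed TWO-SLOT LINEAR FORM
# `u ↦ u₀·D₀·(π₀^{k₁}e_B − π₀^{k₃}e_C) + u₁·D₁N(x)·π₀^{k₁}e_B`

Cell `hodgecm-mathlib` (D-0151), FLOOR 0, crux item H413 = `stmt-HodgeConjecture-24833`, route `HCCMUnconditional`; squad F0∕P3c∕LH4.  THEOREMS ONLY (no `def`, no instance, no
notation, no `sorry`, default heartbeats); ★-only imports; lane `--supports stmt-HodgeConjecture-24833 --as helper` (count-neutral); pays NO row, states NO law.  Consumer: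
LH4-p18 (g0)'s R5 tower file `F0P3cDyRamLabelledOddBoundaryG3` (class-sign read ★ p860847 over a transversal, the `g`-character sums ★ p861281, the stratum sum, the `hG3t`-beyond
head of ★ p861354's `hbeyond` binder); the cell twin is ★ p861330 `F0P3cDyRamLabelledOddPureLatticeG3` (LH4-p11 (g9)), whose §1 this file follows token for token up to the error
bookkeeping (adapted from it).

THE MATHEMATICS (LH4-p11 (g8) `VERDICT-G3row.v1` b6c59e93 §1; LH4-p18 (g0) 15:31:21Z interface).  `M₀ = latt (1 0 0; x ϖ^{ρ+s} 0; y z ϖ^{2ρ})` (`|x| = |y| = 1`, `|z| = |ϖ|^ρ`),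
polarisation `D` (`|D₀| = |D₁| = exp(2ρ+s)`, ★ `v_polarisation_latt_G3`; Gram cancellation `|D₀ + σx·D₁·x| ≤ exp 2ρ`, ★ `v_gram_cancel_latt_G3_le`); the polarisations of `M₀`
are `D·S_F(M₀)` (★ `fibre_isCoset_zero`) and `|u₁ − u₀| ≤ |ϖ|^{ρ+s}` on `S_F(M₀)` (★ `v_sub_le_of_mem_fixedUnitStabilizer_latt_G3`).  On the read `2k₃ + ℓ₀ = n₃ = 2ρ + s + ℓ₀`
and as soon as `n₁ ≥ 2ρ + ℓ₀ + 1` (in force on the whole capped tube `2ρ + 2 + ℓ₀ ≤ min n₁ n₂` of ★ (T1) p861261's `hG3t`, inside the cell or BEYOND it) the top value of the label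
form at the polarisation `D·u` is
`A(u) = D₀u₀(α−1) + D₁u₁N(x)(β−1) = −D₀u₀(β−α) + (u₀(D₀ + D₁N(x)) + (u₁−u₀)D₁N(x))·(β−1)`, `|A(u)| = |ϖ|^{ℓ₀}` (main term; the bracket has valuation `≤ exp 2ρ`),
and with the tower-sign tokens `e_C` of `β − α` at `k₃` and `e_B` of `β − 1` at `k₁` (`2k₁ + ℓ₀ = n₁`; ★ p860907 ∕ p860771 letters: `|ϖ^{−m*}((β−α)·π₀^{−k₃} − e_C t₊)| ≤ 1`,
`|ϖ^{−m*}((β−1)·π₀^{−k₁} − e_B t₊)| ≤ 1`, `π₀ = ϖσϖ`, `t₊ = (ϖ − σϖ)·π₀^{−(d−ℓ₀)∕2}`) one has `A(u) ≡ G(u)·t₊ (mod ϖ^{m*})` for the σ-FIXED LINEAR FORM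
`G(u) = −D₀u₀·π₀^{k₃}e_C + (u₀(D₀ + D₁N(x)) + (u₁ − u₀)D₁N(x))·π₀^{k₁}e_B = u₀·D₀(π₀^{k₁}e_B − π₀^{k₃}e_C) + u₁·D₁N(x)·π₀^{k₁}e_B`
(errors `|D₀π₀^{k₃}| = 1` and `exp 2ρ·|ϖ|^{n₁−ℓ₀} ≤ 1` times `ϖ^{m*}`).  ★ p13's two-slot head `valueClassLabel_latt_hnf_iff_normSign` at `(b, c) = (ρ+s, 2ρ)` therefore reads
(§1 HEAD **`twoSlotLabel_latt_G3`**): for every `u ∈ S_F(M₀)`,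
`valueClassLabel σ ϖ (α−1) (β−1) m* d M₀ (D·u) ↔ normSign σ (u₀·D₀(π₀^{k₁}e_B − π₀^{k₃}e_C) + u₁·D₁N(x)·π₀^{k₁}e_B) = 1`
— the class-sign label shape `λ(u) = ω(u₀G₀ + u₁G₁)` of ★ p860847 `two_mul_labelledOddCount_eq_sum_of_classSign` with EXPLICIT `G₀, G₁`.  In the cell `2ρ + m* ≤ n₁` the
`e_B`-part is `ϖ^{m*}`-small and the read collapses to ★ p861330's one-slot `ω(−D₀e_C)·ω(u₀) = 1`; beyond it the `e_B`-part is the TWIST at depth `Δ₁ = n₁ − ℓ₀ − 2ρ`: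
§2 `twoSlot_linear_eq_twist` (ring identity) `u₀G₀ + u₁G₁ = (−D₀π₀^{k₃}e_C)·(u₀ − (u₀ + u₁·D₁N(x)∕D₀)·(e_B∕e_C)·π₀^{k₁}(π₀^{k₃})⁻¹)` and `v_twist_latt_G3`:
`|(u₀ + u₁·D₁N(x)∕D₀)·π₀^{k₁}(π₀^{k₃})⁻¹| ≤ |ϖ|^{n₁ − 2ρ − ℓ₀}` (LH4-p18's `h(u)`); §3 the CHARACTER FORM `λ(u) = ω(G₀+G₁)·ω(u₀)·ω(1 + (u₁∕u₀ − 1)·c)`: `G₀ + G₁`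
is a unit led by `−D₀π₀^{k₃}e_C` up to depth `Δ₁` (`v_linearSum_latt_G3`), correction depth `n₁ − ρ − ℓ₀` (`v_correction_latt_G3`) — LH4-p17 (g0)'s character mechanism, G₃
letters.  NOT HERE (the sum layer): the class sum over a transversal ∕ the character read, the `g`-sums, the stratum sum.
HONEST LABEL.  Count-neutral (`--supports`); nothing printed is asserted; R5, the table identity (SIG-B2b3), (β-BAL), (β), T₊ remain OPEN; `HC_CM` is proved only modulo the 7
printed citations (2 remaining named inputs: hLiu418 = `stmt-HodgeConjecture-24832`, h413 = `stmt-HodgeConjecture-24833`) until rung 0 closes.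

## References
* [Kottwitz1986BaseChangeUnits] R. E. Kottwitz, *Base change for unit elements of Hecke algebras*, Compositio Math. 60 (1986), §1 pp. 240–241 (signed lattice counts by torus orbits).
* [Rogawski1990] J. D. Rogawski, *Automorphic Representations of Unitary Groups in Three Variables*, Ann. of Math. Stud. 123 (1990), §4.9 Prop. 4.9.1 (a)(b) p. 55, §4.10 p. 58.
* [LanglandsShelstad1987] R. P. Langlands, D. Shelstad, *On the definition of transfer factors*, Math. Ann. 278 (1987), §3 (κ and the sign of a binary norm form).
* [Serre1979] J.-P. Serre, *Local Fields*, GTM 67 (1979), Ch. V §3 Cor. 3 (the norm residue symbol of a ramified quadratic extension and its conductor).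
* [Jacobowitz1962] R. Jacobowitz, *Hermitian forms over local fields*, Amer. J. Math. 84 (1962), §4, §7.
-/

set_option autoImplicit false

noncomputable section

namespace Summit.HodgeConjecture.HodgeConjecture.Cruxes.H413.F0P3cDyRamLabelledOddBoundaryLatticeG3

open Literature.NumberTheory.Automorphic Literature.NumberTheory.Automorphic.HermitianLattice
open Literature.NumberTheory.Automorphic.UnitaryLatticeTree Literature.NumberTheory.Automorphic.UnitaryThreeFourFrame
open Literature.NumberTheory.LocalFields Literature.NumberTheory.LocalFields.WildQuadraticDatum
open Summit.HodgeConjecture.HodgeConjecture.Cruxes.H413.F0P3cDyRamFourFramePieces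
open Summit.HodgeConjecture.HodgeConjecture.Cruxes.H413.F0P3cDyRamFourFrameCensusDefs
open Summit.HodgeConjecture.HodgeConjecture.Cruxes.H413.F0P3cDyRamStageOneBDefs (mcOfRecord)
open Summit.HodgeConjecture.HodgeConjecture.Cruxes.H413.F0P3cDyRamDiagonalTorusDefs
open Summit.HodgeConjecture.HodgeConjecture.Cruxes.H413.F0P3cDyRamDiagonalStrataDefs
open Summit.HodgeConjecture.HodgeConjecture.Cruxes.H413.F0P3cDyRamLabelledOddCountDefs
open Summit.HodgeConjecture.HodgeConjecture.Cruxes.H413.F0P3cDyRamDiagonalOrbitFibreTransport (fibre_isCoset_zero)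
open Summit.HodgeConjecture.HodgeConjecture.Cruxes.H413.F0P3cDyRamDiagonalGluedStratumG3
open Summit.HodgeConjecture.HodgeConjecture.Cruxes.H413.F0P3cDyRamTwoSlotLabelRead (valueClassLabel_latt_hnf_iff_normSign)
open scoped Valued WithZero Matrix MatrixGroups

variable {K : Type} [Field K] [Valued K ℤᵐ⁰] [CompleteSpace K] {σ : K →+* K} {ϖ : K} {d t : ℕ} {α β : K} {N₀ n₁ n₂ n₃ : ℕ}

/-! ## §1  HEAD — the two-slot label on the G₃ normal form, as an explicit σ-fixed linear form in the polarisation -/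

/-- **THE TWO-SLOT LABEL ON THE G₃ NORMAL FORM (R5b input).**  `M₀ = latt (1 0 0; x ϖ^{ρ+s} 0; y z ϖ^{2ρ})` (`|x| = |y| = 1`, `|z| = |ϖ|^ρ`, `ρ, s ≥ 1`), element datum at
`N₀ ≥ mcOfRecord d`, `2 ≤ d`; `M₀` `T`-stable with polarisation `D` and on the clean shell of `X = diag(α−1, β−1, 0)`; READ `2k₃ + ℓ₀ = n₃ = 2ρ + s + ℓ₀`, half-depth `2k₁ + ℓ₀ = n₁` with
`2ρ + ℓ₀ + 1 ≤ n₁` (any point of the capped tube, in or beyond the cell); tokens `e_C` of `β − α` at `k₃` and `e_B` of `β − 1` at `k₁`.  Then for every `u ∈ S_F(M₀)`: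
`valueClassLabel σ ϖ (α−1) (β−1) m* d M₀ (D·u) ↔ normSign σ (u₀·D₀(π₀^{k₁}e_B − π₀^{k₃}e_C) + u₁·D₁N(x)·π₀^{k₁}e_B) = 1` (★ p13 top-A read on `D·u`; ★ p861251 valuations,
Gram cancellation and stabiliser tube bound the errors). [cite: Kottwitz1986BaseChangeUnits, §1 pp. 240–241] [cite: Rogawski1990, §4.9 Prop. 4.9.1 (a)(b) p. 55, §4.10 p. 58]
[cite: LanglandsShelstad1987, §3] [cite: Serre1979, Ch. V §3 Cor. 3] -/
theorem twoSlotLabel_latt_G3 (hD : IsRamifiedQuadraticDatum σ ϖ d t) (h2d : 2 ≤ d)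
    (hE : IsElementDatum σ ϖ N₀ α β n₁ n₂ n₃) (hmc : mcOfRecord d ≤ N₀)
    (T : GL (Fin 3) K) (hT : (T : Matrix (Fin 3) (Fin 3) K) = Matrix.diagonal ![α, β, 1])
    {ρ s : ℕ} (hρ : 1 ≤ ρ) (hs : 1 ≤ s) {x y z : K} (hx : Valued.v x = 1) (hy : Valued.v y = 1) (hz : Valued.v z = Valued.v (ϖ ^ ρ))
    (k₃ : ℕ) (hks : 2 * ρ + s = 2 * k₃) (hk₃ : 2 * k₃ + d % 2 = n₃) (k₁ : ℕ) (hk₁ : 2 * k₁ + d % 2 = n₁) (hn₁ : 2 * ρ + d % 2 + 1 ≤ n₁)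
    {M₀ : Submodule 𝒪[K] (Fin 3 → K)} (hM₀ : M₀ = latt (!![1, 0, 0; x, ϖ ^ (ρ + s), 0; y, z, ϖ ^ (2 * ρ)] : Matrix (Fin 3) (Fin 3) K))
    (hTM : mapGL T M₀ = M₀) {D : Fin 3 → K} (hD₁ : ∀ j, σ (D j) = D j ∧ D j ≠ 0) (hV₁ : IsVertexLattice σ ϖ (Matrix.diagonal D) 0 M₀)
    (hlev : LatticeInLevel ϖ (d % 2) (Matrix.diagonal ![α - 1, β - 1, 0]) M₀) (hnlev : ¬ LatticeInLevel ϖ (d % 2 + 1) (Matrix.diagonal ![α - 1, β - 1, 0]) M₀)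
    (hsq : LatticeInLevel ϖ (mcOfRecord d) (Matrix.diagonal ![(α - 1) * (α - 1), (β - 1) * (β - 1), 0]) M₀)
    {eC : K} (hσeC : σ eC = eC)
    (heC : Valued.v ((ϖ ^ (d % 2 + 2 * d - 1))⁻¹ * ((β - α) * ((ϖ * σ ϖ) ^ k₃)⁻¹ - eC * ((ϖ - σ ϖ) * ((ϖ * σ ϖ) ^ ((d - d % 2) / 2))⁻¹))) ≤ 1)
    {eB : K} (hσeB : σ eB = eB)
    (heB : Valued.v ((ϖ ^ (d % 2 + 2 * d - 1))⁻¹ * ((β - 1) * ((ϖ * σ ϖ) ^ k₁)⁻¹ - eB * ((ϖ - σ ϖ) * ((ϖ * σ ϖ) ^ ((d - d % 2) / 2))⁻¹))) ≤ 1) :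
    ∀ u ∈ fixedUnitStabilizer σ M₀,
      valueClassLabel σ ϖ (α - 1) (β - 1) (d % 2 + 2 * d - 1) d M₀ (fun k => D k * ((u k : Kˣ) : K)) ↔
        normSign σ (((u 0 : Kˣ) : K) * (D 0 * ((ϖ * σ ϖ) ^ k₁ * eB - (ϖ * σ ϖ) ^ k₃ * eC)) +
            ((u 1 : Kˣ) : K) * (D 1 * (σ x * x) * ((ϖ * σ ϖ) ^ k₁ * eB))) = 1 := by
  have hD' := hD
  obtain ⟨hσ, hvσ, hϖ, -, -, -, -⟩ := hD'
  haveI : IsAdicComplete 𝓂[K] 𝒪[K] := isAdicComplete_valuedInteger_of_completeSpace hϖ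
  have hϖ0 : ϖ ≠ 0 := fun h0 => by rw [h0, map_zero] at hϖ; exact WithZero.coe_ne_zero hϖ.symm
  have hϖ1 : Valued.v ϖ ≤ 1 := by rw [hϖ, ← WithZero.exp_zero, WithZero.exp_le_exp]; norm_num
  have hσϖ0 : σ ϖ ≠ 0 := (map_ne_zero σ).2 hϖ0
  have hπ₀σ : σ (ϖ * σ ϖ) = ϖ * σ ϖ := by rw [map_mul, hσ, mul_comm]
  have hπσ : ∀ k : ℕ, σ ((ϖ * σ ϖ) ^ k) = (ϖ * σ ϖ) ^ k := fun k => by rw [map_pow, hπ₀σ]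
  have hπne : ∀ k : ℕ, ((ϖ * σ ϖ) ^ k : K) ≠ 0 := fun k => pow_ne_zero _ (mul_ne_zero hϖ0 hσϖ0)
  have hvπ : ∀ k : ℕ, Valued.v ((ϖ * σ ϖ) ^ k) = WithZero.exp (-((2 * k : ℕ) : ℤ)) := fun k => by
    rw [map_pow, map_mul, hvσ, ← pow_two, ← pow_mul, v_varpi_pow hϖ]
  have hα : Valued.v (α - 1) = Valued.v ϖ ^ n₂ := hE.2.2.2.2.2.2.1
  have hβ : Valued.v (β - 1) = Valued.v ϖ ^ n₁ := hE.2.2.2.2.2.1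
  have hγ : Valued.v (α - β) = Valued.v ϖ ^ n₃ := hE.2.2.2.2.2.2.2.1
  have hN₁ : N₀ ≤ n₁ := hE.2.2.2.2.2.2.2.2.1
  have hN₂ : N₀ ≤ n₂ := hE.2.2.2.2.2.2.2.2.2.1
  have hN₃ : N₀ ≤ n₃ := hE.2.2.2.2.2.2.2.2.2.2
  have hmcv : mcOfRecord d = 2 * ((d % 2 + 2 * d - 1 + d) / 2) := rfl
  have hq : ∀ n : ℕ, Valued.v (ϖ ^ n) = WithZero.exp (-(n : ℤ)) := fun n => by rw [map_pow, v_varpi_pow hϖ]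
  -- ★ p861251: polarisation valuations, Gram cancellation, normalisation, fibre, stabiliser tube
  have hV₁' := hV₁
  rw [hM₀] at hV₁'
  obtain ⟨hvD0, hvD1, -⟩ := v_polarisation_latt_G3 hvσ hϖ (fun k => (hD₁ k).2) hρ hs hx hy hz hV₁'
  have hgram := v_gram_cancel_latt_G3_le hvσ hϖ (fun k => (hD₁ k).2) hρ hs hx hy hz hV₁'
  have hzle : Valued.v z ≤ 1 := by rw [hz, hq, ← WithZero.exp_zero, WithZero.exp_le_exp]; omega
  have hnorm := isNormalisedLattice_latt_G3 hϖ1 hx hy hzle ρ s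
  rw [← hM₀] at hnorm
  have hcoset := fibre_isCoset_zero hvσ ϖ (Matrix.GeneralLinearGroup.mkOfDetNeZero _ (det_latt_G3_ne_zero hϖ0 x y z ρ s)) hM₀ hnorm _ hD₁ hV₁
  have hSF : ∀ u ∈ fixedUnitStabilizer σ M₀, Valued.v (((u 1 : Kˣ) : K) - (u 0 : Kˣ)) ≤ Valued.v (ϖ ^ (ρ + s)) := fun u hu => by
    rw [hM₀] at hu
    exact (v_sub_le_of_mem_fixedUnitStabilizer_latt_G3 σ hϖ0 hϖ1 hx hz hu).1
  have hform : (!![1, 0, 0; x, ϖ ^ (ρ + s), 0; y, z, ϖ ^ (2 * ρ)] : Matrix (Fin 3) (Fin 3) K) =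
      Matrix.of ![![1, 0, 0], ![x, ϖ ^ (ρ + s), 0], ![y, z, ϖ ^ (2 * ρ)]] := rfl
  -- `|D₀·π₀^{k₃}| = 1`, `|N(x)| = 1`
  have hD0π : Valued.v (D 0 * (ϖ * σ ϖ) ^ k₃) = 1 := by
    rw [map_mul, hvD0, hvπ, ← WithZero.exp_add, ← WithZero.exp_zero]; congr 1; push_cast; omega
  have hNx : Valued.v (σ x * x) = 1 := by rw [map_mul, hvσ, hx, one_mul]
  intro u hu
  have h10 : Valued.v (((u 1 : Kˣ) : K) - (u 0 : Kˣ)) ≤ Valued.v (ϖ ^ (ρ + s)) := hSF u hu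
  obtain ⟨huv, huσ⟩ := (mem_fixedUnitTorus_iff σ u).1 (Subgroup.mem_inf.1 (show u ∈ fixedUnitStabilizer σ M₀ from hu)).2
  have hDuσ : ∀ k, σ (D k * ((u k : Kˣ) : K)) = D k * ((u k : Kˣ) : K) := fun k => by rw [map_mul, (hD₁ k).1, huσ k]
  have hDu0 : ∀ k, D k * ((u k : Kˣ) : K) ≠ 0 := fun k => mul_ne_zero (hD₁ k).2 (u k).ne_zero
  have hVu : IsVertexLattice σ ϖ (Matrix.diagonal fun k => D k * ((u k : Kˣ) : K)) 0 M₀ := (hcoset _ fun k => ⟨hDuσ k, hDu0 k⟩).2 ⟨u, hu, fun k => rfl⟩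
  -- the bracket `B(u) = u₀(D₀ + σx·D₁·x) + (u₁−u₀)·D₁N(x)`, `|B(u)| ≤ exp 2ρ`
  set B : K := ((u 0 : Kˣ) : K) * (D 0 + σ x * D 1 * x) + (((u 1 : Kˣ) : K) - (u 0 : Kˣ)) * (D 1 * (σ x * x)) with hBdef
  have hB : Valued.v B ≤ WithZero.exp ((2 * ρ : ℕ) : ℤ) := by
    refine (Valuation.map_add _ _ _).trans (max_le ?_ ?_)
    · rw [map_mul, huv 0, one_mul]; exact hgram
    · rw [map_mul, map_mul, hvD1, hNx, mul_one]
      calc Valued.v (((u 1 : Kˣ) : K) - (u 0 : Kˣ)) * WithZero.exp ((2 * ρ + s : ℕ) : ℤ)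
          ≤ Valued.v (ϖ ^ (ρ + s)) * WithZero.exp ((2 * ρ + s : ℕ) : ℤ) := by gcongr
        _ ≤ WithZero.exp ((2 * ρ : ℕ) : ℤ) := by rw [hq, ← WithZero.exp_add, WithZero.exp_le_exp]; push_cast; omega
  -- the top value `A(u) = −D₀u₀(β−α) + B(u)·(β−1)`, `|A(u)| = |ϖ|^{ℓ₀}`
  have hS : D 0 * ((u 0 : Kˣ) : K) * (α - 1) + D 1 * ((u 1 : Kˣ) : K) * σ x * ((β - 1) * x) =
      -(D 0 * ((u 0 : Kˣ) : K) * (β - α)) + B * (β - 1) := by rw [hBdef]; ring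
  have hmain : Valued.v (-(D 0 * ((u 0 : Kˣ) : K) * (β - α))) = Valued.v (ϖ ^ (d % 2)) := by
    rw [Valuation.map_neg, map_mul, map_mul, hvD0, huv 0, mul_one, Valuation.map_sub_swap, hγ, v_varpi_pow hϖ, ← WithZero.exp_add, hq]
    congr 1; push_cast; omega
  have herr : Valued.v (B * (β - 1)) < Valued.v (ϖ ^ (d % 2)) := by
    rw [map_mul, hβ, v_varpi_pow hϖ, hq]
    calc Valued.v B * WithZero.exp (-(n₁ : ℤ)) ≤ WithZero.exp ((2 * ρ : ℕ) : ℤ) * WithZero.exp (-(n₁ : ℤ)) := by gcongr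
      _ < WithZero.exp (-((d % 2 : ℕ) : ℤ)) := by rw [← WithZero.exp_add, WithZero.exp_lt_exp]; push_cast; omega
  have hA : Valued.v (D 0 * ((u 0 : Kˣ) : K) * (α - 1) + D 1 * ((u 1 : Kˣ) : K) * σ x * ((β - 1) * x)) = Valued.v (ϖ ^ (d % 2)) := by
    rw [hS, Valuation.map_add_eq_of_lt_left _ (by rw [hmain]; exact herr), hmain]
  -- the congruence `A(u) ≡ G(u)·t₊ (mod ϖ^{m*})` with `G(u) = −D₀u₀·π₀^{k₃}e_C + B(u)·π₀^{k₁}e_B`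
  set G : K := ((u 0 : Kˣ) : K) * (D 0 * ((ϖ * σ ϖ) ^ k₁ * eB - (ϖ * σ ϖ) ^ k₃ * eC)) +
    ((u 1 : Kˣ) : K) * (D 1 * (σ x * x) * ((ϖ * σ ϖ) ^ k₁ * eB)) with hGdef
  have hGB : G = -(D 0 * ((u 0 : Kˣ) : K) * eC) * (ϖ * σ ϖ) ^ k₃ + B * ((ϖ * σ ϖ) ^ k₁ * eB) := by rw [hGdef, hBdef]; ring
  have hkey : (ϖ ^ (d % 2 + 2 * d - 1))⁻¹ * ((D 0 * ((u 0 : Kˣ) : K) * (α - 1) + D 1 * ((u 1 : Kˣ) : K) * σ x * ((β - 1) * x)) -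
      G * ((ϖ - σ ϖ) * ((ϖ * σ ϖ) ^ ((d - d % 2) / 2))⁻¹)) =
      -(D 0 * (ϖ * σ ϖ) ^ k₃ * ((u 0 : Kˣ) : K)) *
          ((ϖ ^ (d % 2 + 2 * d - 1))⁻¹ * ((β - α) * ((ϖ * σ ϖ) ^ k₃)⁻¹ - eC * ((ϖ - σ ϖ) * ((ϖ * σ ϖ) ^ ((d - d % 2) / 2))⁻¹))) +
        B * (ϖ * σ ϖ) ^ k₁ *
          ((ϖ ^ (d % 2 + 2 * d - 1))⁻¹ * ((β - 1) * ((ϖ * σ ϖ) ^ k₁)⁻¹ - eB * ((ϖ - σ ϖ) * ((ϖ * σ ϖ) ^ ((d - d % 2) / 2))⁻¹))) := by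
    rw [hS, hGB]
    have h3 : (ϖ * σ ϖ) ^ k₃ * ((ϖ * σ ϖ) ^ k₃)⁻¹ = (1 : K) := mul_inv_cancel₀ (hπne k₃)
    have h1 : (ϖ * σ ϖ) ^ k₁ * ((ϖ * σ ϖ) ^ k₁)⁻¹ = (1 : K) := mul_inv_cancel₀ (hπne k₁)
    linear_combination (D 0 * ((u 0 : Kˣ) : K) * (ϖ ^ (d % 2 + 2 * d - 1))⁻¹ * (β - α)) * h3 -
      (B * (ϖ ^ (d % 2 + 2 * d - 1))⁻¹ * (β - 1)) * h1
  have hG : Valued.v ((ϖ ^ (d % 2 + 2 * d - 1))⁻¹ * ((D 0 * ((u 0 : Kˣ) : K) * (α - 1) + D 1 * ((u 1 : Kˣ) : K) * σ x * ((β - 1) * x)) -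
      G * ((ϖ - σ ϖ) * ((ϖ * σ ϖ) ^ ((d - d % 2) / 2))⁻¹))) ≤ 1 := by
    rw [hkey]
    refine (Valuation.map_add _ _ _).trans (max_le ?_ ?_)
    · rw [map_mul, Valuation.map_neg, map_mul, hD0π, huv 0, one_mul, one_mul]
      exact heC
    · rw [map_mul, map_mul, hvπ]
      calc Valued.v B * WithZero.exp (-((2 * k₁ : ℕ) : ℤ)) * Valued.v ((ϖ ^ (d % 2 + 2 * d - 1))⁻¹ *
              ((β - 1) * ((ϖ * σ ϖ) ^ k₁)⁻¹ - eB * ((ϖ - σ ϖ) * ((ϖ * σ ϖ) ^ ((d - d % 2) / 2))⁻¹)))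
          ≤ WithZero.exp ((2 * ρ : ℕ) : ℤ) * WithZero.exp (-((2 * k₁ : ℕ) : ℤ)) * 1 := by gcongr
        _ ≤ 1 := by rw [mul_one, ← WithZero.exp_add, ← WithZero.exp_zero, WithZero.exp_le_exp]; push_cast; omega
  have hσG : σ G = G := by
    rw [hGdef]
    simp only [map_add, map_sub, map_mul, hπσ, huσ, (hD₁ 0).1, (hD₁ 1).1, hσeB, hσeC, hσ]
    ring
  have hread := valueClassLabel_latt_hnf_iff_normSign hD hDuσ hDu0 (b := ρ + s) (c := 2 * ρ) hx.le hy.le hzle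
    (by rw [← hform, ← hM₀]; exact hnorm) (by rw [← hform, ← hM₀]; exact hVu) hE (mc := mcOfRecord d)
    (by omega) (by omega) (by rw [hmcv]; omega) (by rw [hmcv]; omega)
    (by rw [← hform, ← hM₀]; exact hlev) (by rw [← hform, ← hM₀]; exact hnlev) (by rw [← hform, ← hM₀]; exact hsq) hT (by rw [← hform, ← hM₀]; exact hTM) hA hσG hG
  rw [← hform, ← hM₀] at hread
  exact hread

/-! ## §2  The twist form of the linear form (LH4-p18 (g0)'s `h(u)`) -/

omit [Valued K ℤᵐ⁰] [CompleteSpace K] in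
/-- **THE LINEAR FORM AS A TWISTED LEADING TERM** (ring identity; `D₀, e_C, π₀^{k₃}` invertible):
`u₀·D₀(π₀^{k₁}e_B − π₀^{k₃}e_C) + u₁·D₁N·π₀^{k₁}e_B = (−D₀π₀^{k₃}e_C)·(u₀ − (u₀ + u₁·D₁N∕D₀)·(e_B∕e_C)·π₀^{k₁}·(π₀^{k₃})⁻¹)`. [cite: LanglandsShelstad1987, §3] -/
theorem twoSlot_linear_eq_twist {D₀ D₁N eB eC P₁ P₃ u₀ u₁ : K} (hD₀ : D₀ ≠ 0) (heC : eC ≠ 0) (hP₃ : P₃ ≠ 0) :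
    u₀ * (D₀ * (P₁ * eB - P₃ * eC)) + u₁ * (D₁N * (P₁ * eB)) =
      -(D₀ * P₃ * eC) * (u₀ - (u₀ + u₁ * D₁N / D₀) * (eB / eC) * P₁ * P₃⁻¹) := by
  field_simp
  ring

omit [CompleteSpace K] in
/-- **THE TWIST HAS DEPTH `Δ₁ = n₁ − ℓ₀ − 2ρ`**: on the G₃ normal form with polarisation `D`, for `u ∈ S_F(M₀)`, on the read `2k₃ + ℓ₀ = n₃ = 2ρ+s+ℓ₀` with `2k₁ + ℓ₀ = n₁ ≥ 2ρ + ℓ₀`: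
`|(u₀ + u₁·D₁N(x)∕D₀)·π₀^{k₁}·(π₀^{k₃})⁻¹| ≤ |ϖ|^{n₁ − (2ρ + ℓ₀)}` (`|u₀D₀ + u₁D₁N(x)| ≤ exp 2ρ` by ★ Gram cancellation + ★ tube, `|D₀| = exp(2ρ+s)`, `|π₀^{k₁−k₃}| = |ϖ|^{n₁−n₃}`).
[cite: Kottwitz1986BaseChangeUnits, §1 pp. 240–241] [cite: Serre1979, Ch. V §3 Cor. 3] -/
theorem v_twist_latt_G3 (hD : IsRamifiedQuadraticDatum σ ϖ d t)
    {ρ s : ℕ} (hρ : 1 ≤ ρ) (hs : 1 ≤ s) {x y z : K} (hx : Valued.v x = 1) (hy : Valued.v y = 1) (hz : Valued.v z = Valued.v (ϖ ^ ρ))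
    (k₃ : ℕ) (hks : 2 * ρ + s = 2 * k₃) (hk₃ : 2 * k₃ + d % 2 = n₃) (k₁ : ℕ) (hk₁ : 2 * k₁ + d % 2 = n₁) (hn₁ : 2 * ρ + d % 2 ≤ n₁)
    {M₀ : Submodule 𝒪[K] (Fin 3 → K)} (hM₀ : M₀ = latt (!![1, 0, 0; x, ϖ ^ (ρ + s), 0; y, z, ϖ ^ (2 * ρ)] : Matrix (Fin 3) (Fin 3) K))
    {D : Fin 3 → K} (hD₁ : ∀ j, σ (D j) = D j ∧ D j ≠ 0) (hV₁ : IsVertexLattice σ ϖ (Matrix.diagonal D) 0 M₀)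
    {u : Fin 3 → Kˣ} (hu : u ∈ fixedUnitStabilizer σ M₀) :
    Valued.v ((((u 0 : Kˣ) : K) + ((u 1 : Kˣ) : K) * (D 1 * (σ x * x)) / D 0) * (ϖ * σ ϖ) ^ k₁ * ((ϖ * σ ϖ) ^ k₃)⁻¹) ≤
      Valued.v ϖ ^ (n₁ - (2 * ρ + d % 2)) := by
  have hD' := hD
  obtain ⟨hσ, hvσ, hϖ, -, -, -, -⟩ := hD'
  have hϖ0 : ϖ ≠ 0 := fun h0 => by rw [h0, map_zero] at hϖ; exact WithZero.coe_ne_zero hϖ.symm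
  have hϖ1 : Valued.v ϖ ≤ 1 := by rw [hϖ, ← WithZero.exp_zero, WithZero.exp_le_exp]; norm_num
  have hσϖ0 : σ ϖ ≠ 0 := (map_ne_zero σ).2 hϖ0
  have hvπ : ∀ k : ℕ, Valued.v ((ϖ * σ ϖ) ^ k) = WithZero.exp (-((2 * k : ℕ) : ℤ)) := fun k => by
    rw [map_pow, map_mul, hvσ, ← pow_two, ← pow_mul, v_varpi_pow hϖ]
  have hq : ∀ n : ℕ, Valued.v (ϖ ^ n) = WithZero.exp (-(n : ℤ)) := fun n => by rw [map_pow, v_varpi_pow hϖ]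
  have hV₁' := hV₁
  rw [hM₀] at hV₁'
  obtain ⟨hvD0, hvD1, -⟩ := v_polarisation_latt_G3 hvσ hϖ (fun k => (hD₁ k).2) hρ hs hx hy hz hV₁'
  have hgram := v_gram_cancel_latt_G3_le hvσ hϖ (fun k => (hD₁ k).2) hρ hs hx hy hz hV₁'
  have hu' := hu
  rw [hM₀] at hu'
  have h10 := (v_sub_le_of_mem_fixedUnitStabilizer_latt_G3 σ hϖ0 hϖ1 hx hz hu').1
  obtain ⟨huv, -⟩ := (mem_fixedUnitTorus_iff σ u).1 (Subgroup.mem_inf.1 (show u ∈ fixedUnitStabilizer σ M₀ from hu)).2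
  have hNx : Valued.v (σ x * x) = 1 := by rw [map_mul, hvσ, hx, one_mul]
  have hD00 : D 0 ≠ 0 := (hD₁ 0).2
  -- `u₀ + u₁·D₁N∕D₀ = (u₀(D₀ + σx D₁ x) + (u₁ − u₀)·D₁N) ∕ D₀`
  have hsplit : ((u 0 : Kˣ) : K) + ((u 1 : Kˣ) : K) * (D 1 * (σ x * x)) / D 0 =
      (((u 0 : Kˣ) : K) * (D 0 + σ x * D 1 * x) + (((u 1 : Kˣ) : K) - (u 0 : Kˣ)) * (D 1 * (σ x * x))) / D 0 := by
    field_simp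
    ring
  have hB : Valued.v (((u 0 : Kˣ) : K) * (D 0 + σ x * D 1 * x) + (((u 1 : Kˣ) : K) - (u 0 : Kˣ)) * (D 1 * (σ x * x))) ≤ WithZero.exp ((2 * ρ : ℕ) : ℤ) := by
    refine (Valuation.map_add _ _ _).trans (max_le ?_ ?_)
    · rw [map_mul, huv 0, one_mul]; exact hgram
    · rw [map_mul, map_mul, hvD1, hNx, mul_one]
      calc Valued.v (((u 1 : Kˣ) : K) - (u 0 : Kˣ)) * WithZero.exp ((2 * ρ + s : ℕ) : ℤ)
          ≤ Valued.v (ϖ ^ (ρ + s)) * WithZero.exp ((2 * ρ + s : ℕ) : ℤ) := by gcongr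
        _ ≤ WithZero.exp ((2 * ρ : ℕ) : ℤ) := by rw [hq, ← WithZero.exp_add, WithZero.exp_le_exp]; push_cast; omega
  rw [hsplit, div_eq_mul_inv, map_mul, map_mul, map_mul, map_inv₀, map_inv₀, hvD0, hvπ, hvπ, v_varpi_pow hϖ, ← WithZero.exp_neg, ← WithZero.exp_neg]
  calc Valued.v (((u 0 : Kˣ) : K) * (D 0 + σ x * D 1 * x) + (((u 1 : Kˣ) : K) - (u 0 : Kˣ)) * (D 1 * (σ x * x))) *
          WithZero.exp (-((2 * ρ + s : ℕ) : ℤ)) * WithZero.exp (-((2 * k₁ : ℕ) : ℤ)) * WithZero.exp (-(-((2 * k₃ : ℕ) : ℤ)))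
      ≤ WithZero.exp ((2 * ρ : ℕ) : ℤ) * WithZero.exp (-((2 * ρ + s : ℕ) : ℤ)) * WithZero.exp (-((2 * k₁ : ℕ) : ℤ)) * WithZero.exp (-(-((2 * k₃ : ℕ) : ℤ))) := by
        gcongr
    _ = WithZero.exp (-((n₁ - (2 * ρ + d % 2) : ℕ) : ℤ)) := by
        rw [← WithZero.exp_add, ← WithZero.exp_add, ← WithZero.exp_add]; congr 1; push_cast; omega

/-! ## §3  The character form: `u₀G₀ + u₁G₁ = (G₀+G₁)·u₀·(1 + (u₁∕u₀ − 1)·G₁∕(G₀+G₁))`, `G₀ + G₁` a unit led by `−D₀π₀^{k₃}e_C`, correction depth `n₁ − ρ − ℓ₀` -/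

omit [Valued K ℤᵐ⁰] [CompleteSpace K] in
/-- **LEADING-TERM FACTORISATION OF THE LINEAR FORM** (ring identity; `u₀`, `G₀ + G₁` invertible): `u₀G₀ + u₁G₁ = (G₀+G₁)·u₀·(1 + (u₁∕u₀ − 1)·(G₁∕(G₀+G₁)))` — on
`S_F(M₀)` the class-sign `λ(u) = ω(u₀G₀ + u₁G₁)` is `ω(G₀+G₁)·ω(u₀)·ω(1 + (u₁∕u₀ − 1)·c)`, `c = G₁∕(G₀+G₁)` (LH4-p17 (g0)'s character shape on G₁, here for G₃). [cite: LanglandsShelstad1987, §3] -/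
theorem linear_eq_sum_mul_one_add {G₀ G₁ u₀ u₁ : K} (hu₀ : u₀ ≠ 0) (hS : G₀ + G₁ ≠ 0) :
    u₀ * G₀ + u₁ * G₁ = (G₀ + G₁) * u₀ * (1 + (u₁ / u₀ - 1) * (G₁ / (G₀ + G₁))) := by
  field_simp
  ring

omit [CompleteSpace K] in
/-- **`G₀ + G₁` IS A UNIT LED BY `−D₀π₀^{k₃}e_C`**: with `G₀ = D₀(π₀^{k₁}e_B − π₀^{k₃}e_C)`, `G₁ = D₁N(x)π₀^{k₁}e_B` on the G₃ normal form (polarisation `D`; tokens `e_B, e_C` UNITS;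
read `2k₃ + ℓ₀ = n₃ = 2ρ+s+ℓ₀`, `2k₁ + ℓ₀ = n₁`, `2ρ + ℓ₀ + 1 ≤ n₁`): `|(G₀ + G₁) − (−D₀π₀^{k₃}e_C)| ≤ |ϖ|^{n₁ − (2ρ + ℓ₀)}` (the twist depth `Δ₁`), hence `|G₀ + G₁| = 1`,
and `|G₁| = |ϖ|^{n₁ − (2ρ + ℓ₀)}·|ϖ^s|⁻¹` written as `|G₁|·|ϖ^{2ρ+s+ℓ₀}| = |ϖ^{n₁}|` (so `c = G₁∕(G₀+G₁)` has `|c| = |ϖ|^{n₁−n₃}` in `ℤ`-exponents).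
[cite: Kottwitz1986BaseChangeUnits, §1 pp. 240–241] [cite: Serre1979, Ch. V §3 Cor. 3] -/
theorem v_linearSum_latt_G3 (hD : IsRamifiedQuadraticDatum σ ϖ d t)
    {ρ s : ℕ} (hρ : 1 ≤ ρ) (hs : 1 ≤ s) {x y z : K} (hx : Valued.v x = 1) (hy : Valued.v y = 1) (hz : Valued.v z = Valued.v (ϖ ^ ρ))
    (k₃ : ℕ) (hks : 2 * ρ + s = 2 * k₃) (k₁ : ℕ) (hk₁ : 2 * k₁ + d % 2 = n₁) (hn₁ : 2 * ρ + d % 2 + 1 ≤ n₁)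
    {M₀ : Submodule 𝒪[K] (Fin 3 → K)} (hM₀ : M₀ = latt (!![1, 0, 0; x, ϖ ^ (ρ + s), 0; y, z, ϖ ^ (2 * ρ)] : Matrix (Fin 3) (Fin 3) K))
    {D : Fin 3 → K} (hD₁ : ∀ j, σ (D j) = D j ∧ D j ≠ 0) (hV₁ : IsVertexLattice σ ϖ (Matrix.diagonal D) 0 M₀)
    {eC : K} (heC1 : Valued.v eC = 1) {eB : K} (heB1 : Valued.v eB = 1) :
    Valued.v (D 0 * ((ϖ * σ ϖ) ^ k₁ * eB - (ϖ * σ ϖ) ^ k₃ * eC) + D 1 * (σ x * x) * ((ϖ * σ ϖ) ^ k₁ * eB) - (-(D 0 * (ϖ * σ ϖ) ^ k₃ * eC))) ≤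
        Valued.v ϖ ^ (n₁ - (2 * ρ + d % 2)) ∧
      Valued.v (D 0 * ((ϖ * σ ϖ) ^ k₁ * eB - (ϖ * σ ϖ) ^ k₃ * eC) + D 1 * (σ x * x) * ((ϖ * σ ϖ) ^ k₁ * eB)) = 1 ∧
      Valued.v (D 1 * (σ x * x) * ((ϖ * σ ϖ) ^ k₁ * eB)) * Valued.v (ϖ ^ (2 * ρ + s + d % 2)) = Valued.v (ϖ ^ n₁) := by
  have hD' := hD
  obtain ⟨hσ, hvσ, hϖ, -, -, -, -⟩ := hD'
  have hϖ0 : ϖ ≠ 0 := fun h0 => by rw [h0, map_zero] at hϖ; exact WithZero.coe_ne_zero hϖ.symm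
  have hvπ : ∀ k : ℕ, Valued.v ((ϖ * σ ϖ) ^ k) = WithZero.exp (-((2 * k : ℕ) : ℤ)) := fun k => by
    rw [map_pow, map_mul, hvσ, ← pow_two, ← pow_mul, v_varpi_pow hϖ]
  have hq : ∀ n : ℕ, Valued.v (ϖ ^ n) = WithZero.exp (-(n : ℤ)) := fun n => by rw [map_pow, v_varpi_pow hϖ]
  have hV₁' := hV₁
  rw [hM₀] at hV₁'
  obtain ⟨hvD0, hvD1, -⟩ := v_polarisation_latt_G3 hvσ hϖ (fun k => (hD₁ k).2) hρ hs hx hy hz hV₁'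
  have hgram := v_gram_cancel_latt_G3_le hvσ hϖ (fun k => (hD₁ k).2) hρ hs hx hy hz hV₁'
  have hNx : Valued.v (σ x * x) = 1 := by rw [map_mul, hvσ, hx, one_mul]
  have hlead : Valued.v (-(D 0 * (ϖ * σ ϖ) ^ k₃ * eC)) = 1 := by
    rw [Valuation.map_neg, map_mul, map_mul, hvD0, hvπ, heC1, mul_one, ← WithZero.exp_add, ← WithZero.exp_zero]; congr 1; push_cast; omega
  -- the twist `(D₀ + σx·D₁·x)·π₀^{k₁}·e_B` has depth `Δ₁ = n₁ − ℓ₀ − 2ρ`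
  have hsum : D 0 * ((ϖ * σ ϖ) ^ k₁ * eB - (ϖ * σ ϖ) ^ k₃ * eC) + D 1 * (σ x * x) * ((ϖ * σ ϖ) ^ k₁ * eB) - (-(D 0 * (ϖ * σ ϖ) ^ k₃ * eC)) =
      (D 0 + σ x * D 1 * x) * ((ϖ * σ ϖ) ^ k₁ * eB) := by ring
  have htwist : Valued.v ((D 0 + σ x * D 1 * x) * ((ϖ * σ ϖ) ^ k₁ * eB)) ≤ Valued.v ϖ ^ (n₁ - (2 * ρ + d % 2)) := by
    rw [map_mul, map_mul, hvπ, heB1, mul_one, v_varpi_pow hϖ]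
    calc Valued.v (D 0 + σ x * D 1 * x) * WithZero.exp (-((2 * k₁ : ℕ) : ℤ))
        ≤ WithZero.exp ((2 * ρ : ℕ) : ℤ) * WithZero.exp (-((2 * k₁ : ℕ) : ℤ)) := by gcongr
      _ = WithZero.exp (-((n₁ - (2 * ρ + d % 2) : ℕ) : ℤ)) := by rw [← WithZero.exp_add]; congr 1; push_cast; omega
  refine ⟨by rw [hsum]; exact htwist, ?_, ?_⟩
  · have hlt : Valued.v ((D 0 + σ x * D 1 * x) * ((ϖ * σ ϖ) ^ k₁ * eB)) < Valued.v (-(D 0 * (ϖ * σ ϖ) ^ k₃ * eC)) := by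
      rw [hlead]
      refine htwist.trans_lt ?_
      rw [v_varpi_pow hϖ, ← WithZero.exp_zero, WithZero.exp_lt_exp]; omega
    have h := Valuation.map_add_eq_of_lt_left Valued.v (x := -(D 0 * (ϖ * σ ϖ) ^ k₃ * eC)) (y := (D 0 + σ x * D 1 * x) * ((ϖ * σ ϖ) ^ k₁ * eB)) hlt
    rw [hlead] at h
    rw [show D 0 * ((ϖ * σ ϖ) ^ k₁ * eB - (ϖ * σ ϖ) ^ k₃ * eC) + D 1 * (σ x * x) * ((ϖ * σ ϖ) ^ k₁ * eB) =
      -(D 0 * (ϖ * σ ϖ) ^ k₃ * eC) + (D 0 + σ x * D 1 * x) * ((ϖ * σ ϖ) ^ k₁ * eB) by ring]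
    exact h
  · rw [map_mul, map_mul, hvD1, hNx, mul_one, map_mul, hvπ, heB1, mul_one, hq, hq, ← WithZero.exp_add, ← WithZero.exp_add]; congr 1; push_cast; omega

omit [CompleteSpace K] in
/-- **THE CORRECTION TERM HAS DEPTH `n₁ − ρ − ℓ₀`**: for `u ∈ S_F(M₀)` (so `|u₁∕u₀ − 1| ≤ |ϖ|^{ρ+s}`, ★ `v_sub_le_of_mem_fixedUnitStabilizer_latt_G3`) and `c = G₁∕(G₀+G₁)`:
`|(u₁∕u₀ − 1)·c| ≤ |ϖ|^{n₁ − (ρ + ℓ₀)}` — so `u ↦ ω(1 + (u₁∕u₀ − 1)·c)` is a character of `S_F(M₀)` as soon as `(n₁ − ρ − ℓ₀) + (ρ + s) ≥ 2d − 1` (derived regime), and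
trivial as soon as `n₁ − ρ − ℓ₀ ≥ 2d − 1` (LH4-p17 (g0)'s indicator mechanism, G₃ letters). [cite: Serre1979, Ch. V §3 Cor. 3] [cite: Kottwitz1986BaseChangeUnits, §1 pp. 240–241] -/
theorem v_correction_latt_G3 (hD : IsRamifiedQuadraticDatum σ ϖ d t)
    {ρ s : ℕ} (hρ : 1 ≤ ρ) (hs : 1 ≤ s) {x y z : K} (hx : Valued.v x = 1) (hy : Valued.v y = 1) (hz : Valued.v z = Valued.v (ϖ ^ ρ))
    (k₃ : ℕ) (hks : 2 * ρ + s = 2 * k₃) (k₁ : ℕ) (hk₁ : 2 * k₁ + d % 2 = n₁) (hn₁ : 2 * ρ + d % 2 + 1 ≤ n₁)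
    {M₀ : Submodule 𝒪[K] (Fin 3 → K)} (hM₀ : M₀ = latt (!![1, 0, 0; x, ϖ ^ (ρ + s), 0; y, z, ϖ ^ (2 * ρ)] : Matrix (Fin 3) (Fin 3) K))
    {D : Fin 3 → K} (hD₁ : ∀ j, σ (D j) = D j ∧ D j ≠ 0) (hV₁ : IsVertexLattice σ ϖ (Matrix.diagonal D) 0 M₀)
    {eC : K} (heC1 : Valued.v eC = 1) {eB : K} (heB1 : Valued.v eB = 1) {u : Fin 3 → Kˣ} (hu : u ∈ fixedUnitStabilizer σ M₀) :
    Valued.v ((((u 1 : Kˣ) : K) / ((u 0 : Kˣ) : K) - 1) *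
        (D 1 * (σ x * x) * ((ϖ * σ ϖ) ^ k₁ * eB) / (D 0 * ((ϖ * σ ϖ) ^ k₁ * eB - (ϖ * σ ϖ) ^ k₃ * eC) + D 1 * (σ x * x) * ((ϖ * σ ϖ) ^ k₁ * eB)))) ≤
      Valued.v ϖ ^ (n₁ - (ρ + d % 2)) := by
  have hD' := hD
  obtain ⟨hσ, hvσ, hϖ, -, -, -, -⟩ := hD'
  have hϖ0 : ϖ ≠ 0 := fun h0 => by rw [h0, map_zero] at hϖ; exact WithZero.coe_ne_zero hϖ.symm
  have hϖ1 : Valued.v ϖ ≤ 1 := by rw [hϖ, ← WithZero.exp_zero, WithZero.exp_le_exp]; norm_num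
  have hq : ∀ n : ℕ, Valued.v (ϖ ^ n) = WithZero.exp (-(n : ℤ)) := fun n => by rw [map_pow, v_varpi_pow hϖ]
  obtain ⟨-, hS1, hG1⟩ := v_linearSum_latt_G3 (n₁ := n₁) hD hρ hs hx hy hz k₃ hks k₁ hk₁ hn₁ hM₀ hD₁ hV₁ heC1 heB1
  have hu' := hu
  rw [hM₀] at hu'
  have h10 := (v_sub_le_of_mem_fixedUnitStabilizer_latt_G3 σ hϖ0 hϖ1 hx hz hu').1
  obtain ⟨huv, -⟩ := (mem_fixedUnitTorus_iff σ u).1 (Subgroup.mem_inf.1 (show u ∈ fixedUnitStabilizer σ M₀ from hu)).2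
  have hquot : Valued.v (((u 1 : Kˣ) : K) / ((u 0 : Kˣ) : K) - 1) ≤ Valued.v (ϖ ^ (ρ + s)) := by
    rw [show ((u 1 : Kˣ) : K) / ((u 0 : Kˣ) : K) - 1 = (((u 1 : Kˣ) : K) - (u 0 : Kˣ)) / ((u 0 : Kˣ) : K) by field_simp, map_div₀, huv 0, div_one]
    exact h10
  have hG1v : Valued.v (D 1 * (σ x * x) * ((ϖ * σ ϖ) ^ k₁ * eB)) = WithZero.exp (((2 * ρ + s + d % 2 : ℕ) : ℤ) - n₁) := by
    have h := hG1
    rw [hq, hq] at h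
    have hne : WithZero.exp (-((2 * ρ + s + d % 2 : ℕ) : ℤ)) ≠ 0 := WithZero.exp_ne_zero
    calc Valued.v (D 1 * (σ x * x) * ((ϖ * σ ϖ) ^ k₁ * eB))
        = Valued.v (D 1 * (σ x * x) * ((ϖ * σ ϖ) ^ k₁ * eB)) * WithZero.exp (-((2 * ρ + s + d % 2 : ℕ) : ℤ)) *
            (WithZero.exp (-((2 * ρ + s + d % 2 : ℕ) : ℤ)))⁻¹ := by rw [mul_inv_cancel_right₀ hne]
      _ = WithZero.exp (-(n₁ : ℤ)) * (WithZero.exp (-((2 * ρ + s + d % 2 : ℕ) : ℤ)))⁻¹ := by rw [h]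
      _ = WithZero.exp (((2 * ρ + s + d % 2 : ℕ) : ℤ) - n₁) := by rw [← WithZero.exp_neg, ← WithZero.exp_add]; congr 1; ring
  rw [map_mul, map_div₀, hS1, div_one, hG1v]
  calc Valued.v (((u 1 : Kˣ) : K) / ((u 0 : Kˣ) : K) - 1) * WithZero.exp (((2 * ρ + s + d % 2 : ℕ) : ℤ) - n₁)
      ≤ Valued.v (ϖ ^ (ρ + s)) * WithZero.exp (((2 * ρ + s + d % 2 : ℕ) : ℤ) - n₁) := by gcongr
    _ = Valued.v ϖ ^ (n₁ - (ρ + d % 2)) := by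
        rw [hq, v_varpi_pow hϖ, ← WithZero.exp_add]; congr 1; push_cast; omega

end Summit.HodgeConjecture.HodgeConjecture.Cruxes.H413.F0P3cDyRamLabelledOddBoundaryLatticeG3

end
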